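import Summits.HodgeConjecture.CorCM.HodgeLieLefschetzCodimension
import Summits.HodgeConjecture.CorCM.MumfordTateRankTypeTwoLefschetz
import Literature.LinearAlgebra.QuadraticForm.TraceFormDescent
import Literature.Algebra.Lie.SymplecticAlgebraDimension
import Literature.AlgebraicGeometry.HodgeTheory.RealMultiplicationMumfordTateRank
import HarnessLib

/-!
# Type I(e): the Lefschetz Lie algebra of an abelian variety with multiplication by a totally real field

Sub-problem `CorCM` of `HodgeConjecture` (cell `pub-hodgecm2`, count-neutral Mumford–Tate-rank lane of seat `b27`; theorems only,
no new definition, no named fact; nothing here uses or asserts `HC_CM`).  Let `B` be a complex abelian variety whose endomorphism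
algebra `End⁰B` IS a totally real number field `K` of degree `e` (Albert type I(e); `K`-algebra structure with `K → End⁰B`
bijective), `dim B = em`, and let `ψ` be a polarization of `H¹(B, ℚ)`; `Lef(ψ) = C(End_Hdg(H¹B)) ∩ 𝔰𝔭(ψ)`, `t = dim MT(H¹B)`.

1. `exists_finrank_lefschetz_eq_of_field` — the engine: `e · n = dim_ℚ H¹B` and `2 · dim_ℚ Lef(ψ) = e · n(n+1)`:
   `Lef(ψ) = Res_{K/ℚ} 𝔰𝔭(H¹B, ψ_K)` with `ψ = Tr_{K/ℚ} ∘ ψ_K` (`LinearAlgebra/QuadraticForm/TraceFormDescent`) and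
   `dim_K 𝔰𝔭_n = n(n+1)/2` (`Algebra/Lie/SymplecticAlgebraDimension`).
2. `finrank_lefschetz_eq_of_field` — **`dim Lef(ψ) = e · m(2m+1)`** (Milne's `dim S(A)` for type I: `Res_{F/ℚ} Sp_{2m}`); hence
   `finrank_hodgeLie_hodge_one_le_of_field` / `mtRank_hodge_one_le_of_field` — **`dim Lie Hg(H¹B) ≤ e · m(2m+1)`, `t ≤ e · m(2m+1) + 1`**
   (for `e = 1` the symplectic bound `g(2g+1)` of `CorCM/MumfordTateRankTrivialEndomorphisms`; for `m = 1` Ribet's `R_{E/ℚ} SL₂`,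
   `t ≤ 3g + 1`).
3. `mtRank_hodge_one_ne_lefschetz_of_field` — **the rank `t = e · m(2m+1)` is skipped** (no codimension one,
   `CorCM/HodgeLieLefschetzCodimension`); `hodgeLie_hodge_one_eq_lefschetz_iff_of_field` — **Hodge = Lefschetz iff
   `dim Lie Hg(H¹B) = e · m(2m+1)`** (Ribet 1983 Thm. 1: this holds when `m` is odd; Mumford's fourfolds, `e = 1`, `m = 4`... are
   the classical failures — neither is claimed here).

## References
* [Milne1999LefschetzClasses] J. S. Milne, *Lefschetz classes on abelian varieties*, Duke Math. J. 96 (1999), §2 and Summary (type I: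
  `C(A) = Res_{F/ℚ} Sp`, `ψ` arises from an `F`-bilinear form by the trace).
* [Ribet1983] K. A. Ribet, *Hodge classes on certain types of abelian varieties*, Amer. J. Math. 105 (1983), Thm. 0–1.
* [MoonenZarhin1999LowDim] B. Moonen, Yu. G. Zarhin, *Hodge classes on abelian varieties of low dimension*, Math. Ann. 315 (1999), §1.
-/

noncomputable section

namespace Summit.HodgeConjecture.CorCM

open scoped TensorProduct
open CategoryTheory CategoryTheory.Limits Module NumberField
open Literature.AlgebraicGeometry.Motives
open Literature.AlgebraicGeometry.Motives.AbelianVariety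
open Literature.AlgebraicGeometry.Motives.HodgeStructure
open Literature.AlgebraicGeometry.HodgeTheory
open Literature.AlgebraicGeometry.ComplexMultiplication (bettiRep bettiRep_injective)
open Literature.RingTheory.CentralSimple
open Literature.Algebra.Lie
open Literature.LinearAlgebra.QuadraticForm

variable [HodgeTensorFacts.{0, 0}]

/-! ## §0 Preliminaries -/

/-- `Lie Hg(H¹X) ⊆ Lef(ψ)`: the Hodge Lie algebra commutes with the Hodge endomorphisms and is `ψ`-skew.
[cite: MoonenZarhin1999LowDim, §1] -/
theorem hodgeLie_hodge_one_le_lefschetz {X : AbelianVariety ℂ} {n : ℕ} (hX : IsSmoothProjective n X.X)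
    [Module.Finite ℚ (bettiCohomology X.X 1)] (ψ : (BettiUniverse.hodge exists_isReal_hodgeModel_holds hX 1).Polarization) :
    (BettiUniverse.hodge exists_isReal_hodgeModel_holds hX 1).hodgeLie ≤
      Subalgebra.toSubmodule (Subalgebra.centralizer ℚ
          ((BettiUniverse.hodge exists_isReal_hodgeModel_holds hX 1).endAlg : Set (Module.End ℚ (bettiCohomology X.X 1)))) ⊓
        ψ.form.skewAdjointSubmodule := by
  intro Y hY
  refine Submodule.mem_inf.2 ⟨?_, ?_⟩
  · rw [Subalgebra.mem_toSubmodule, Subalgebra.mem_centralizer_iff]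
    exact fun g hg => (commute_of_mem_hodgeLie _ hY ⟨g, hg⟩).symm
  · rw [LinearMap.mem_skewAdjointSubmodule]
    intro v w
    rw [Pi.neg_apply, map_neg, ← add_eq_zero_iff_eq_neg]
    exact form_apply_add_eq_zero_of_mem_hodgeLie ψ hY v w

omit [HodgeTensorFacts.{0, 0}] in
/-- No factor of type IV when `End⁰B` is a totally real field (type I). [cite: MoonenZarhin1999LowDim, §1] -/
theorem hasNoTypeIVFactor_of_field {B : AbelianVariety ℂ} {K : Type} [Field K] [NumberField K] [IsTotallyReal K]
    [Algebra K B.endAlgebra] [IsScalarTower ℚ K B.endAlgebra] (hK : Function.Bijective (algebraMap K B.endAlgebra)) :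
    HasNoTypeIVFactor B := by
  intro z _
  obtain ⟨c, rfl⟩ := hK.2 z
  have hint : IsIntegral ℚ c := Algebra.IsIntegral.isIntegral c
  refine ⟨minpoly ℚ c, minpoly.ne_zero hint, ?_, fun x hx => ?_⟩
  · rw [Polynomial.aeval_algebraMap_apply, minpoly.aeval, map_zero]
  · have hx' : x ∈ (minpoly ℚ c).rootSet ℂ := by
      rw [Polynomial.mem_rootSet]
      exact ⟨minpoly.ne_zero hint, hx⟩
    rw [← NumberField.Embeddings.range_eval_eq_rootSet_minpoly] at hx'
    obtain ⟨φ, rfl⟩ := hx'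
    have hreal := NumberField.ComplexEmbedding.isReal_iff.1 (IsTotallyReal.complexEmbedding_isReal (K := K) φ)
    exact Complex.conj_eq_iff_im.1 (by simpa using RingHom.congr_fun hreal c)

/-! ## §1 The engine: `Lef(ψ) = Res_{K/ℚ} 𝔰𝔭(H¹B, ψ_K)` -/

/-- **The Lefschetz Lie algebra of type I(e).**  If `End⁰B` is a totally real number field `K` of degree `e` (the structure map
`K → End⁰B` is bijective) and `ψ` is a polarization of `H¹B`, then `e · n = dim_ℚ H¹B` and `2 · dim_ℚ (C(End_Hdg(H¹B)) ∩ 𝔰𝔭(ψ)) =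
e · n(n+1)` with `n = dim_K H¹B`: the Lefschetz Lie algebra is the restriction of scalars of `𝔰𝔭(H¹B, ψ_K)`, `ψ = Tr_{K/ℚ} ∘ ψ_K`.
[cite: Milne1999LefschetzClasses, §2 and Summary] [cite: Ribet1983, Thm. 0–1] -/
theorem exists_finrank_lefschetz_eq_of_field {B : AbelianVariety ℂ} {K : Type} [Field K] [NumberField K] [IsTotallyReal K]
    [Algebra K B.endAlgebra] [IsScalarTower ℚ K B.endAlgebra] (hK : Function.Bijective (algebraMap K B.endAlgebra))
    [Module.Finite ℚ (bettiCohomology B.X 1)]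
    (ψ : (BettiUniverse.hodge exists_isReal_hodgeModel_holds (AbelianVariety.isSmoothProjective_holds (A := B)) 1).Polarization) :
    ∃ n : ℕ, Module.finrank ℚ K * n = Module.finrank ℚ (bettiCohomology B.X 1) ∧
      2 * Module.finrank ℚ ↥(Subalgebra.toSubmodule (Subalgebra.centralizer ℚ
          ((BettiUniverse.hodge exists_isReal_hodgeModel_holds (AbelianVariety.isSmoothProjective_holds (A := B)) 1).endAlg :
            Set (Module.End ℚ (bettiCohomology B.X 1)))) ⊓ ψ.form.skewAdjointSubmodule) =
        Module.finrank ℚ K * (n * (n + 1)) := by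
  classical
  have hHD : exists_isReal_hodgeModel := exists_isReal_hodgeModel_holds
  have hI : hodgePQ_independent_of_hodgeModel := hodgePQ_independent_of_hodgeModel_holds
  have hX : IsSmoothProjective B.dim B.X := AbelianVariety.isSmoothProjective_holds
  have hA4 : HasNoTypeIVFactor B := hasNoTypeIVFactor_of_field hK
  -- `ρ = unop ∘ bettiRep`, Riemann's anti-isomorphism onto `End_Hdg(H¹B)`
  let ρ : B.endAlgebra → Module.End ℚ (bettiCohomology B.X 1) := fun z => MulOpposite.unop (bettiRep B z)
  have hρ : ∀ z, ρ z = MulOpposite.unop (bettiRep B z) := fun z => rfl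
  have hρmul : ∀ z w, ρ (z * w) = ρ w * ρ z := fun z w => by rw [hρ, hρ, hρ, map_mul, MulOpposite.unop_mul]
  have hρadd : ∀ z w, ρ (z + w) = ρ z + ρ w := fun z w => by rw [hρ, hρ, hρ, map_add, MulOpposite.unop_add]
  have hρzero : ρ 0 = 0 := by rw [hρ, map_zero, MulOpposite.unop_zero]
  have hρone : ρ 1 = 1 := by rw [hρ, map_one, MulOpposite.unop_one]
  have hρrat : ∀ r : ℚ, ρ (algebraMap ℚ B.endAlgebra r) = r • (1 : Module.End ℚ (bettiCohomology B.X 1)) := fun r => by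
    rw [hρ, AlgHom.commutes, MulOpposite.algebraMap_apply, MulOpposite.unop_op, Algebra.algebraMap_eq_smul_one]
  have hρA : ∀ z, ρ z ∈ (BettiUniverse.hodge exists_isReal_hodgeModel_holds (AbelianVariety.isSmoothProjective_holds (A := B)) 1).endAlg := fun z =>
    Literature.AlgebraicGeometry.ComplexMultiplication.unop_bettiRep_mem_endAlg hHD hI z
  have hτρ : ∀ z, ψ.adjoint (ρ z) =
      ρ (AbelianVariety.rosati B exists_isReal_hodgeModel_holds hodgePQ_independent_of_hodgeModel_holds ψ z) :=
    fun z => (AbelianVariety.unop_bettiRep_rosati hHD hI ψ z).symm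
  obtain ⟨Lef, hLef⟩ : ∃ Lef : Submodule ℚ (Module.End ℚ (bettiCohomology B.X 1)), Lef =
      Subalgebra.toSubmodule (Subalgebra.centralizer ℚ
        ((BettiUniverse.hodge exists_isReal_hodgeModel_holds (AbelianVariety.isSmoothProjective_holds (A := B)) 1).endAlg :
          Set (Module.End ℚ (bettiCohomology B.X 1)))) ⊓ ψ.form.skewAdjointSubmodule := ⟨_, rfl⟩
  have hmemLef : ∀ {Y : Module.End ℚ (bettiCohomology B.X 1)}, Y ∈ Lef ↔
      (∀ g ∈ (BettiUniverse.hodge exists_isReal_hodgeModel_holds (AbelianVariety.isSmoothProjective_holds (A := B)) 1).endAlg,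
        g * Y = Y * g) ∧ ∀ x y, ψ.form (Y x) y = -ψ.form x (Y y) := fun {Y} => by
    rw [hLef, Submodule.mem_inf, Subalgebra.mem_toSubmodule, Subalgebra.mem_centralizer_iff, LinearMap.mem_skewAdjointSubmodule]
    refine and_congr_right fun _ => forall_congr' fun x => forall_congr' fun y => ?_
    rw [Pi.neg_apply, map_neg]
  rw [← hLef]
  -- the centre `K` acts by Rosati-fixed endomorphisms commuting with `ρ(End⁰B)`
  have hcenK : ∀ (c : K) (z : B.endAlgebra), ρ (algebraMap K _ c) * ρ z = ρ z * ρ (algebraMap K _ c) := fun c z => by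
    rw [← hρmul, ← hρmul, Algebra.commutes]
  have hrosK : ∀ c : K, AbelianVariety.rosati B exists_isReal_hodgeModel_holds hodgePQ_independent_of_hodgeModel_holds ψ (algebraMap K _ c) = algebraMap K _ c := fun c =>
    AbelianVariety.rosati_eq_self_of_mem_center hHD hI ψ hA4 (Subalgebra.mem_center_iff.2 fun z => (Algebra.commutes c z).symm)
  -- `H¹B` as a `K`-vector space
  let f : K →+* Module.End ℚ (bettiCohomology B.X 1) :=
    { toFun := fun c => ρ (algebraMap K _ c)
      map_one' := by rw [map_one, hρone]
      map_mul' := fun c c' => by rw [mul_comm c c', map_mul, hρmul]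
      map_zero' := by rw [map_zero, hρzero]
      map_add' := fun c c' => by rw [map_add, hρadd] }
  letI : Module K (bettiCohomology B.X 1) := Module.compHom _ f
  have hsmulK : ∀ (c : K) (x : bettiCohomology B.X 1), c • x = ρ (algebraMap K _ c) x := fun c x => rfl
  haveI : IsScalarTower ℚ K (bettiCohomology B.X 1) := ⟨fun q c x => by
    rw [hsmulK, hsmulK, Algebra.smul_def, map_mul, ← IsScalarTower.algebraMap_apply ℚ K B.endAlgebra q, hρmul, hρrat,
      Module.End.mul_apply, LinearMap.smul_apply, Module.End.one_apply, map_smul]⟩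
  haveI : Module.Finite K (bettiCohomology B.X 1) := Module.Finite.of_restrictScalars_finite ℚ K _
  -- `ψ` is `K`-balanced (Rosati fixes the centre) and descends along the trace
  have hbal : ∀ (c : K) (x y : bettiCohomology B.X 1), ψ.form (c • x) y = ψ.form x (c • y) := fun c x y => by
    rw [hsmulK, hsmulK, ← ψ.form_apply_adjoint (ρ (algebraMap K _ c)) x y, hτρ, hrosK]
  obtain ⟨ψK, hψK⟩ := TraceFormDescent.exists_forall_trace_mul_eq (k := ℚ) ψ.form hbal
  have hψanti : ∀ x y : bettiCohomology B.X 1, ψ.form y x = -ψ.form x y := fun x y => by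
    have h := LinearMap.congr_fun₂ ψ.flip_form x y
    rw [show (((1 : ℕ) : ℤ).negOnePow : ℤˣ) = -1 from Int.negOnePow_one, Units.val_neg, Units.val_one, neg_one_zsmul] at h
    simpa only [LinearMap.BilinForm.flip_apply, LinearMap.neg_apply] using h
  have hψKanti : ∀ x y, ψK y x = -ψK x y := (TraceFormDescent.flip_eq_neg_iff_of_trace hψK hbal).1 hψanti
  have hψKflip : ψK.flip = -ψK := LinearMap.ext fun x => LinearMap.ext fun y => by
    rw [LinearMap.BilinForm.flip_apply, LinearMap.neg_apply, LinearMap.neg_apply, hψKanti]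
  have hψKL : ∀ x, (∀ y, ψK x y = 0) → x = 0 := TraceFormDescent.separatingLeft_of_trace hψK ψ.nondegenerate.1
  have hψKnd : ψK.Nondegenerate := ⟨hψKL, fun y hy => hψKL y fun x => by rw [hψKanti, hy x, neg_zero]⟩
  -- every element of `Lef(ψ)` is `K`-linear and `ψ_K`-skew
  obtain ⟨MK, hMK⟩ : ∃ MK : Submodule K (bettiCohomology B.X 1 →ₗ[K] bettiCohomology B.X 1), MK = ψK.skewAdjointSubmodule :=
    ⟨_, rfl⟩
  have hlift : ∀ Y ∈ Lef, ∃ T : bettiCohomology B.X 1 →ₗ[K] bettiCohomology B.X 1, (∀ x, T x = Y x) ∧ T ∈ MK := by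
    intro Y hY
    have hcommY : ∀ z, Y * ρ z = ρ z * Y := fun z => ((hmemLef.1 hY).1 (ρ z) (hρA z)).symm
    obtain ⟨T, hT⟩ : ∃ T : bettiCohomology B.X 1 →ₗ[K] bettiCohomology B.X 1, ∀ x, T x = Y x :=
      ⟨{ toFun := Y, map_add' := map_add Y, map_smul' := fun c x => by
          rw [RingHom.id_apply, hsmulK, hsmulK, ← Module.End.mul_apply, hcommY, Module.End.mul_apply] }, fun x => rfl⟩
    refine ⟨T, hT, ?_⟩
    rw [hMK, LinearMap.mem_skewAdjointSubmodule]
    have h := (TraceFormDescent.isAdjointPair_iff_of_trace hψK T (-T)).1 fun x y => by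
      rw [hT, LinearMap.neg_apply, hT, map_neg]
      exact (hmemLef.1 hY).2 x y
    intro x y
    rw [Pi.neg_apply, h x y, LinearMap.neg_apply]
  -- conversely, every `ψ_K`-skew `K`-linear map lies in `Lef(ψ)` (`End_Hdg = ρ(End⁰B) = ρ(K)`)
  have hdesc : ∀ T ∈ MK, (T.restrictScalars ℚ : Module.End ℚ (bettiCohomology B.X 1)) ∈ Lef := by
    intro T hTM
    rw [hMK, LinearMap.mem_skewAdjointSubmodule] at hTM
    refine hmemLef.2 ⟨fun g hg => ?_, fun x y => ?_⟩
    · obtain ⟨z, hz⟩ := exists_unop_bettiRep_eq_of_mem_endAlg (AbelianVariety.isSmoothProjective_holds (A := B)) hg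
      obtain ⟨c, rfl⟩ := hK.2 z
      refine LinearMap.ext fun x => ?_
      rw [Module.End.mul_apply, Module.End.mul_apply, LinearMap.restrictScalars_apply, LinearMap.restrictScalars_apply, ← hz,
        ← hρ, ← hsmulK, ← hsmulK, map_smul]
    · have h := (TraceFormDescent.isAdjointPair_iff_of_trace hψK T (-T)).2 fun x y => by
        rw [LinearMap.neg_apply, ← Pi.neg_apply (T : bettiCohomology B.X 1 → bettiCohomology B.X 1) y]; exact hTM x y
      rw [LinearMap.restrictScalars_apply, LinearMap.restrictScalars_apply, h, LinearMap.neg_apply, map_neg]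
  -- the two `ℚ`-linear injections `Lef(ψ) ↪ M_K ↪ Lef(ψ)`
  choose T hT hTmem using hlift
  let Φ : Lef →ₗ[ℚ] MK :=
    { toFun := fun Y => ⟨T Y Y.2, hTmem Y Y.2⟩
      map_add' := fun Y Y' => Subtype.ext (LinearMap.ext fun x => by
        change T _ (Y + Y').2 x = T Y Y.2 x + T Y' Y'.2 x
        rw [hT, hT, hT]
        rfl)
      map_smul' := fun r Y => Subtype.ext (LinearMap.ext fun x => by
        change T _ (r • Y).2 x = r • T Y Y.2 x
        rw [hT, hT]
        rfl) }
  have hΦ : Function.Injective Φ := by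
    intro Y Y' h
    apply Subtype.ext
    refine LinearMap.ext fun x => ?_
    have h' : T Y Y.2 = T Y' Y'.2 := congrArg Subtype.val h
    rw [← hT Y Y.2, ← hT Y' Y'.2, h']
  let Ψ : MK →ₗ[ℚ] Lef :=
    { toFun := fun S => ⟨(S : bettiCohomology B.X 1 →ₗ[K] bettiCohomology B.X 1).restrictScalars ℚ, hdesc S S.2⟩
      map_add' := fun S S' => rfl
      map_smul' := fun r S => rfl }
  have hΨ : Function.Injective Ψ := by
    intro S S' h
    apply Subtype.ext
    refine LinearMap.ext fun x => ?_
    exact LinearMap.congr_fun (congrArg Subtype.val h) x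
  haveI : Module.Finite K MK := inferInstance
  haveI : Module.Finite ℚ MK := Module.Finite.trans K MK
  have hle := LinearMap.finrank_le_finrank_of_injective hΦ
  have hge := LinearMap.finrank_le_finrank_of_injective hΨ
  have hMKq : Module.finrank ℚ MK = Module.finrank ℚ K * Module.finrank K MK := (Module.finrank_mul_finrank ℚ K MK).symm
  have hn : Module.finrank ℚ K * Module.finrank K (bettiCohomology B.X 1) = Module.finrank ℚ (bettiCohomology B.X 1) :=
    Module.finrank_mul_finrank ℚ K (bettiCohomology B.X 1)
  refine ⟨Module.finrank K (bettiCohomology B.X 1), hn, ?_⟩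
  rw [le_antisymm hle hge, hMKq, Nat.mul_left_comm, hMK, SymplecticDimension.two_mul_finrank_skewAdjointSubmodule_of_flip_eq_neg ψK hψKnd hψKflip]

/-! ## §2 `dim Lef(ψ) = e · m(2m+1)`, the bound, the skipped rank, and the Hodge = Lefschetz criterion -/

/-- **Type I(e): `dim (C(End_Hdg(H¹B)) ∩ 𝔰𝔭(ψ)) = e · m(2m+1)`** for `End⁰B` a totally real field of degree `e` and `dim B = em`
(Milne: `C(A) = S(A) = Res_{F/ℚ} Sp_{2m}`; Ribet: `R_{E/ℚ} Sp_{2r, E}`). [cite: Milne1999LefschetzClasses, §2 and Summary]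
[cite: Ribet1983, Thm. 0–1] -/
theorem finrank_lefschetz_eq_of_field {B : AbelianVariety ℂ} {k : ℕ} (hB : IsSmoothProjective k B.X) {K : Type} [Field K]
    [NumberField K] [IsTotallyReal K] [Algebra K B.endAlgebra] [IsScalarTower ℚ K B.endAlgebra]
    (hK : Function.Bijective (algebraMap K B.endAlgebra)) {m : ℕ} (hBm : B.dim = m * Module.finrank ℚ K)
    [Module.Finite ℚ (bettiCohomology B.X 1)] (ψ : (BettiUniverse.hodge exists_isReal_hodgeModel_holds hB 1).Polarization) :
    Module.finrank ℚ ↥(Subalgebra.toSubmodule (Subalgebra.centralizer ℚ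
        ((BettiUniverse.hodge exists_isReal_hodgeModel_holds hB 1).endAlg : Set (Module.End ℚ (bettiCohomology B.X 1)))) ⊓
      ψ.form.skewAdjointSubmodule) = Module.finrank ℚ K * (m * (2 * m + 1)) := by
  have hk : B.dim = k := schemeDim_eq_holds hB
  subst hk
  obtain ⟨n, hn, hdim⟩ := exists_finrank_lefschetz_eq_of_field (B := B) hK ψ
  have hdimV : Module.finrank ℚ (bettiCohomology B.X 1) = Module.finrank ℚ K * (2 * m) := by
    rw [finrank_bettiCohomology_one_eq_two_mul_dim B, hBm]; ring
  have he : 0 < Module.finrank ℚ K := Module.finrank_pos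
  have hn2 : n = 2 * m := Nat.eq_of_mul_eq_mul_left he (by rw [hn, hdimV])
  subst hn2
  have h2 : Module.finrank ℚ K * (2 * m * (2 * m + 1)) = 2 * (Module.finrank ℚ K * (m * (2 * m + 1))) := by ring
  rw [h2] at hdim
  omega

/-- **`dim Lie Hg(H¹B) ≤ e · m(2m+1)`** for `End⁰B` a totally real field of degree `e`, `dim B = em` (`Hg ⊆ Res_{F/ℚ} Sp_{2m}`).
[cite: Milne1999LefschetzClasses, §2 and Summary] [cite: Ribet1983, Thm. 0–1] -/
theorem finrank_hodgeLie_hodge_one_le_of_field {B : AbelianVariety ℂ} {k : ℕ} (hB : IsSmoothProjective k B.X) {K : Type}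
    [Field K] [NumberField K] [IsTotallyReal K] [Algebra K B.endAlgebra] [IsScalarTower ℚ K B.endAlgebra]
    (hK : Function.Bijective (algebraMap K B.endAlgebra)) {m : ℕ} (hBm : B.dim = m * Module.finrank ℚ K) :
    haveI := BettiUniverse.finite hB 1
    Module.finrank ℚ (BettiUniverse.hodge exists_isReal_hodgeModel_holds hB 1).hodgeLie ≤ Module.finrank ℚ K * (m * (2 * m + 1)) := by
  haveI := BettiUniverse.finite hB 1
  obtain ⟨ψ⟩ := BettiUniverse.hodge_isPolarizable exists_isReal_hodgeModel_holds hB 1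
  rw [← finrank_lefschetz_eq_of_field hB hK hBm ψ]
  exact Submodule.finrank_mono (hodgeLie_hodge_one_le_lefschetz hB ψ)

/-- **`dim MT(H¹B) ≤ e · m(2m+1) + 1`** for `End⁰B` a totally real field of degree `e`, `dim B = em > 0`.
[cite: Milne1999LefschetzClasses, §2 and Summary] [cite: Ribet1983, Thm. 0–1] -/
theorem mtRank_hodge_one_le_of_field {B : AbelianVariety ℂ} {k : ℕ} (hB : IsSmoothProjective k B.X) {K : Type}
    [Field K] [NumberField K] [IsTotallyReal K] [Algebra K B.endAlgebra] [IsScalarTower ℚ K B.endAlgebra]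
    (hK : Function.Bijective (algebraMap K B.endAlgebra)) {m : ℕ} (hm : 0 < m) (hBm : B.dim = m * Module.finrank ℚ K) :
    haveI := BettiUniverse.finite hB 1
    (BettiUniverse.hodge exists_isReal_hodgeModel_holds hB 1).mtRank ≤ Module.finrank ℚ K * (m * (2 * m + 1)) + 1 := by
  haveI := BettiUniverse.finite hB 1
  have h0 : 0 < B.dim := by rw [hBm]; exact Nat.mul_pos hm Module.finrank_pos
  have h := finrank_hodgeLie_hodge_one_le_of_field hB hK hBm
  rw [mtRank_hodge_one_eq_finrank_hodgeLie_add_one hB h0]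
  omega

/-- **The rank `t = e · m(2m+1)` is skipped (type I(e)):** `dim MT(H¹B) ≠ e · m(2m+1)` — `Lie Hg ⊆ Lef(ψ)` is never of codimension
one (no type IV). [cite: Milne1999LefschetzClasses, §2 and Summary] [cite: MoonenZarhin1999LowDim, §1] -/
theorem mtRank_hodge_one_ne_lefschetz_of_field {B : AbelianVariety ℂ} {k : ℕ} (hB : IsSmoothProjective k B.X) {K : Type}
    [Field K] [NumberField K] [IsTotallyReal K] [Algebra K B.endAlgebra] [IsScalarTower ℚ K B.endAlgebra]
    (hK : Function.Bijective (algebraMap K B.endAlgebra)) {m : ℕ} (hm : 0 < m) (hBm : B.dim = m * Module.finrank ℚ K) :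
    haveI := BettiUniverse.finite hB 1
    (BettiUniverse.hodge exists_isReal_hodgeModel_holds hB 1).mtRank ≠ Module.finrank ℚ K * (m * (2 * m + 1)) := by
  haveI := BettiUniverse.finite hB 1
  obtain ⟨ψ⟩ := BettiUniverse.hodge_isPolarizable exists_isReal_hodgeModel_holds hB 1
  have h0 : 0 < B.dim := by rw [hBm]; exact Nat.mul_pos hm Module.finrank_pos
  have hne := finrank_lefschetz_ne_finrank_hodgeLie_add_one hB (hasNoTypeIVFactor_of_field hK) ψ
  rw [finrank_lefschetz_eq_of_field hB hK hBm ψ] at hne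
  rw [mtRank_hodge_one_eq_finrank_hodgeLie_add_one hB h0]
  exact fun h => hne h.symm

/-- **Hodge = Lefschetz criterion (type I(e)):** `Lie Hg(H¹B) = C(End_Hdg(H¹B)) ∩ 𝔰𝔭(ψ)` iff `dim Lie Hg(H¹B) = e · m(2m+1)`
(Ribet 1983 Thm. 1 proves the right-hand side for `m` odd). [cite: Ribet1983, Thm. 0–1] [cite: Milne1999LefschetzClasses, §2, Prop. 4.8] -/
theorem hodgeLie_hodge_one_eq_lefschetz_iff_of_field {B : AbelianVariety ℂ} {k : ℕ} (hB : IsSmoothProjective k B.X) {K : Type}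
    [Field K] [NumberField K] [IsTotallyReal K] [Algebra K B.endAlgebra] [IsScalarTower ℚ K B.endAlgebra]
    (hK : Function.Bijective (algebraMap K B.endAlgebra)) {m : ℕ} (hBm : B.dim = m * Module.finrank ℚ K)
    [Module.Finite ℚ (bettiCohomology B.X 1)] (ψ : (BettiUniverse.hodge exists_isReal_hodgeModel_holds hB 1).Polarization) :
    (BettiUniverse.hodge exists_isReal_hodgeModel_holds hB 1).hodgeLie = Subalgebra.toSubmodule (Subalgebra.centralizer ℚ
        ((BettiUniverse.hodge exists_isReal_hodgeModel_holds hB 1).endAlg : Set (Module.End ℚ (bettiCohomology B.X 1)))) ⊓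
      ψ.form.skewAdjointSubmodule ↔
      Module.finrank ℚ (BettiUniverse.hodge exists_isReal_hodgeModel_holds hB 1).hodgeLie =
        Module.finrank ℚ K * (m * (2 * m + 1)) := by
  have hL := finrank_lefschetz_eq_of_field hB hK hBm ψ
  refine ⟨fun h => by rw [h, hL], fun h => Submodule.eq_of_le_of_finrank_eq (hodgeLie_hodge_one_le_lefschetz hB ψ) ?_⟩
  rw [h, hL]

/-! ## §3 Real multiplication of relative dimension one: Hodge = Lefschetz -/

open Literature.AlgebraicGeometry.ComplexMultiplication (EndField EndField.toEndAlgebra) in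
/-- **Hodge = Lefschetz for real multiplication of relative dimension one** (`End⁰B` a totally real field of degree `dim B`,
`m = 1`): `Lie Hg(H¹B) = C(End_Hdg(H¹B)) ∩ 𝔰𝔭(ψ)`, both of dimension `3 dim B` — Ribet's `Hg(B) = R_{E/ℚ} SL₂ = Lef(B)` at the
level of Lie algebras, from the tree's rank formula `dim Lie Hg(H¹B) = 3 dim B` (`HodgeTheory/RealMultiplicationMumfordTateRank`)
and the criterion of §2. [cite: Ribet1983, Thm. 0–1] [cite: Milne1999LefschetzClasses, §2, Prop. 4.8] -/
theorem hodgeLie_hodge_one_eq_lefschetz_of_field_of_dim_eq {B : AbelianVariety ℂ} {k : ℕ} (hB : IsSmoothProjective k B.X)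
    {K : Type} [Field K] [NumberField K] [IsTotallyReal K] [Algebra K B.endAlgebra] [IsScalarTower ℚ K B.endAlgebra]
    (hK : Function.Bijective (algebraMap K B.endAlgebra)) (hBK : B.dim = Module.finrank ℚ K)
    [Module.Finite ℚ (bettiCohomology B.X 1)] (ψ : (BettiUniverse.hodge exists_isReal_hodgeModel_holds hB 1).Polarization) :
    (BettiUniverse.hodge exists_isReal_hodgeModel_holds hB 1).hodgeLie = Subalgebra.toSubmodule (Subalgebra.centralizer ℚ
        ((BettiUniverse.hodge exists_isReal_hodgeModel_holds hB 1).endAlg : Set (Module.End ℚ (bettiCohomology B.X 1)))) ⊓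
      ψ.form.skewAdjointSubmodule := by
  have hk : B.dim = k := schemeDim_eq_holds hB
  subst hk
  have hF : IsField B.endAlgebra :=
    MulEquiv.isField (Field.toIsField K) (RingEquiv.ofBijective (algebraMap K B.endAlgebra) hK).symm.toMulEquiv
  haveI : IsTotallyReal (EndField B hF) :=
    IsTotallyReal.ofRingEquiv ((RingEquiv.ofBijective (algebraMap K B.endAlgebra) hK).trans (EndField.toEndAlgebra hF).symm)
  have hdeg : Module.finrank ℚ B.endAlgebra = B.dim := by
    rw [hBK]
    exact (LinearEquiv.ofBijective ((Algebra.linearMap K B.endAlgebra).restrictScalars ℚ) hK).finrank_eq.symm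
  obtain ⟨-, h3⟩ := mtRank_hodge_one_of_isTotallyReal' hF hB hdeg
  refine (hodgeLie_hodge_one_eq_lefschetz_iff_of_field hB hK (m := 1) (by rw [one_mul]; exact hBK) ψ).2 ?_
  rw [h3, hBK]
  ring

end Summit.HodgeConjecture.CorCM

end
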